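import Literature.IUT.HodgeTheaters.GlobalFrobenioidsArithBNatEndRigidity
import Literature.IUT.HodgeTheaters.Cor53iArithHratOfMonoidRigidity
import HarnessLib

/-!
# [IUTchI] Cor 5.3 (i) at `ℱ^⊛(†𝒟^⊚)`: the binder `hB` (𝔹-RATIO, Ex 5.1 (v)) FROM a units-transport statement — the knit
# of the BRATIO split «(a) C411-UNITS@ARITH + (b) BRIGID-KUMMER ⇒ hB»

S. Mochizuki, *Inter-universal Teichmüller theory I*, kurims manuscript (May 2020), §5 Corollary 5.3 (i) p. 144 l. 2–11, proof
p. 144 l. 24–33 («follows immediately from the category-theoreticity of the "isomorphism `𝕄^⊛(†𝒟^⊚) ⥲ †𝕄^⊛`" of Example 5.1,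
(v)»); Example 5.1 (v) pp. 127–129 ([IUTchI] Cor 5.3 (i) p.144) [claim: Mochizuki2012, status: disputed] (D-0012 claim key;
nothing of the series is asserted; no side taken on [IUTchIII] Cor. 3.12).  The mathematics used is [FrdI]: S. Mochizuki, *The
geometry of Frobenioids I*, Kyushu J. Math. **62** (2008), Thm 5.2 (i)/(ii) pp. 100–101, Cor 4.10 p. 90, Ex 6.3 p. 113
[cite: MochizukiFrdI2008, Thm. 5.2(ii) p.101].

PROOF-ONLY (cell abc-iut, seat abc-iut-L5-t16 gen 13; GAP-LEDGER G-L5t11g16-2 / D-G-L5t11g16-2, BRATIO split of abc-iut-L5-lead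
RULINGS #159/#160/#161 (4): (a) «C411-UNITS@ARITH» abc-iut-L5-t11, (b) «BRIGID-KUMMER» ★ this seat's
`GaloisEquivariantUnitsEndomorphismRigidity` / `UnitsFunctorAutRigidity` / `GlobalFrobenioidsArithBNatEndRigidity`, (c) knit).
THIS FILE is the (b)+(c) side of the knit, with the (a)-statement DISPLAYED AS A HYPOTHESIS `hA` in abc-iut-L5-t11's announced
currency (sizing memo HOME/staging/L5/L5-t11/g17/C411-UNITS-ARITH-SIZING.md § 3): for every self-equivalence `Ψ` of
`ℱ^⊛(†𝒟^⊚)` and every identification `η' : Ψ ⋙ Base ≅ Base` there is a family of automorphisms `ᾱ_A : 𝔹(A) ⥲ 𝔹(A)` natural on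
`†𝒟^⊛`, moving `Div_B` at every object through an automorphism of `Φ^⊛`, through which `Ψ` transports the birational units of
parallel linear arrows (`u_{Ψ f} · η'^*(ᾱ u_g) = u_{Ψ g} · η'^*(ᾱ u_f)`).  CONCLUSIONS: `hB` VERBATIM
(`Cor53.arith_ratioRigid_of_unitsTransport`: the family is the identity by (b), so the transport law IS the ratio law), hence
`RigidOverBase (arith F).modelBase` (`hker⊛`) and Cor 5.3 (i) AS PRINTED modulo `hlift⊛`, through abc-iut-L5-t11's
★ `Cor53.arith_rigidOverBase_of_ratioRigid` / `arith_descendBijective_of_ratioRigid_of_lifts`.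
HONEST TAGS: `hA` is DISPLAYED, not proved here (row (a)); no token moves on this file alone; typed ≠ proved; nothing here
asserts abc proved or refuted.
-/

noncomputable section

set_option backward.isDefEq.respectTransparency false

namespace Literature.IUT.HodgeTheaters

open CategoryTheory Opposite Literature.AlgebraicGeometry.Frobenioids

namespace Cor53

variable (F : Type) [Field F] [NumberField F]

/-- **`hB` (𝔹-RATIO) from units transport.**  If every self-equivalence `Ψ` of `ℱ^⊛(†𝒟^⊚)` with an identification
`η' : Ψ ⋙ Base ≅ Base` transports the birational units of parallel linear arrows through a family `ᾱ_A : 𝔹(A) ⥲ 𝔹(A)`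
that is natural on `†𝒟^⊛` and moves `Div_B` at every object through an automorphism of `Φ^⊛` (the (a)-half, DISPLAYED —
exactly the conclusion of abc-iut-L5-t11's `Cor53.arith_exists_unitsAut_of_overBase`),
then `hB` holds VERBATIM: the family is the identity (`GlobalDivisorData.arith_B_unitsFamily_apply_eq_self_of_divB_compat`,
the (b)-half, classical). ([IUTchI] Cor 5.3 (i) p.144) [cite: MochizukiFrdI2008, Thm. 5.2(ii) p.101]
[claim: Mochizuki2012, status: disputed] -/
theorem arith_ratioRigid_of_unitsTransport
    (hA : ∀ (Ψ : (GlobalDivisorData.arith F).ModelGlobalFrobenioid ≌ (GlobalDivisorData.arith F).ModelGlobalFrobenioid)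
      (η' : Ψ.functor ⋙ (GlobalDivisorData.arith F).modelBase ≅ (GlobalDivisorData.arith F).modelBase),
      ∃ ᾱ : ∀ A : BaseCat (absGalGrp F),
          (GlobalDivisorData.arith F).B.obj (op A) ≃* (GlobalDivisorData.arith F).B.obj (op A),
        (∀ ⦃A' A : BaseCat (absGalGrp F)⦄ (g : A' ⟶ A) (w : (GlobalDivisorData.arith F).B.obj (op A)),
          ᾱ A' (pull (GlobalDivisorData.arith F).B g w) = pull (GlobalDivisorData.arith F).B g (ᾱ A w)) ∧
        (∀ A : BaseCat (absGalGrp F),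
          ∃ ε : (GlobalDivisorData.arith F).Φ.obj (op A) ≃* (GlobalDivisorData.arith F).Φ.obj (op A),
            ∀ w : (GlobalDivisorData.arith F).B.obj (op A),
              divB (GlobalDivisorData.arith F).Φ (GlobalDivisorData.arith F).B (GlobalDivisorData.arith F).div (op A) (ᾱ A w) =
                MonGp.map ε.toMonoidHom
                  (divB (GlobalDivisorData.arith F).Φ (GlobalDivisorData.arith F).B (GlobalDivisorData.arith F).div (op A) w)) ∧
        (∀ ⦃X Y : (GlobalDivisorData.arith F).ModelGlobalFrobenioid⦄ (f g : X ⟶ Y), ModelFrobenioid.degFr f = 1 →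
          ModelFrobenioid.degFr g = 1 → ModelFrobenioid.baseMap f = ModelFrobenioid.baseMap g →
            ModelFrobenioid.unit (Ψ.functor.map f) *
                pull (GlobalDivisorData.arith F).B (A := X.base) (B := (Ψ.functor.obj X).base) (η'.hom.app X)
                  (ᾱ X.base (ModelFrobenioid.unit g)) =
              ModelFrobenioid.unit (Ψ.functor.map g) *
                pull (GlobalDivisorData.arith F).B (A := X.base) (B := (Ψ.functor.obj X).base) (η'.hom.app X)
                  (ᾱ X.base (ModelFrobenioid.unit f)))) :
    ∀ Ψ : (GlobalDivisorData.arith F).ModelGlobalFrobenioid ≌ (GlobalDivisorData.arith F).ModelGlobalFrobenioid,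
      Nonempty (Ψ.functor ⋙ (GlobalDivisorData.arith F).modelBase ≅ (GlobalDivisorData.arith F).modelBase) →
      ∃ η : Ψ.functor ⋙ (GlobalDivisorData.arith F).modelBase ≅ (GlobalDivisorData.arith F).modelBase,
        ∀ ⦃X Y : (GlobalDivisorData.arith F).ModelGlobalFrobenioid⦄ (f g : X ⟶ Y), ModelFrobenioid.degFr f = 1 →
          ModelFrobenioid.degFr g = 1 → ModelFrobenioid.baseMap f = ModelFrobenioid.baseMap g →
            ModelFrobenioid.unit (Ψ.functor.map f) *
                pull (GlobalDivisorData.arith F).B (A := X.base) (B := (Ψ.functor.obj X).base) (η.hom.app X)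
                  (ModelFrobenioid.unit g) =
              ModelFrobenioid.unit (Ψ.functor.map g) *
                pull (GlobalDivisorData.arith F).B (A := X.base) (B := (Ψ.functor.obj X).base) (η.hom.app X)
                  (ModelFrobenioid.unit f) := by
  intro Ψ hΨ
  obtain ⟨η'⟩ := hΨ
  obtain ⟨ᾱ, hnat, hdiv, hratio⟩ := hA Ψ η'
  -- one object of `†𝒟^⊛` (connected, non-empty) and the `Div_B`-law there
  obtain ⟨A₀⟩ := (isGraphConnected_baseCat (absGalGrp F)).nonempty
  obtain ⟨e, hdiv₀⟩ := hdiv A₀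
  have h1 : ∀ (A : BaseCat (absGalGrp F)) (w : (GlobalDivisorData.arith F).B.obj (op A)), ᾱ A w = w :=
    GlobalDivisorData.arith_B_unitsFamily_apply_eq_self_of_divB_compat F ᾱ hnat A₀ e hdiv₀
  refine ⟨η', fun X Y f g hf hg hb => ?_⟩
  have h := hratio f g hf hg hb
  rwa [h1, h1] at h

/-- **`hker⊛` from units transport**: `RigidOverBase (arith F).modelBase` — every self-equivalence of `ℱ^⊛(†𝒟^⊚)` over
the identity of `†𝒟^⊛` is isomorphic to the identity — from the (a)-half DISPLAYED as `hA`, through `hB`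
(`arith_ratioRigid_of_unitsTransport`) and abc-iut-L5-t11's ★ `Cor53.arith_rigidOverBase_of_ratioRigid`.
([IUTchI] Cor 5.3 (i) p.144) [cite: MochizukiFrdI2008, Thm. 5.2(ii) p.101] [claim: Mochizuki2012, status: disputed] -/
theorem arith_rigidOverBase_of_unitsTransport
    (hA : ∀ (Ψ : (GlobalDivisorData.arith F).ModelGlobalFrobenioid ≌ (GlobalDivisorData.arith F).ModelGlobalFrobenioid)
      (η' : Ψ.functor ⋙ (GlobalDivisorData.arith F).modelBase ≅ (GlobalDivisorData.arith F).modelBase),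
      ∃ ᾱ : ∀ A : BaseCat (absGalGrp F),
          (GlobalDivisorData.arith F).B.obj (op A) ≃* (GlobalDivisorData.arith F).B.obj (op A),
        (∀ ⦃A' A : BaseCat (absGalGrp F)⦄ (g : A' ⟶ A) (w : (GlobalDivisorData.arith F).B.obj (op A)),
          ᾱ A' (pull (GlobalDivisorData.arith F).B g w) = pull (GlobalDivisorData.arith F).B g (ᾱ A w)) ∧
        (∀ A : BaseCat (absGalGrp F),
          ∃ ε : (GlobalDivisorData.arith F).Φ.obj (op A) ≃* (GlobalDivisorData.arith F).Φ.obj (op A),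
            ∀ w : (GlobalDivisorData.arith F).B.obj (op A),
              divB (GlobalDivisorData.arith F).Φ (GlobalDivisorData.arith F).B (GlobalDivisorData.arith F).div (op A) (ᾱ A w) =
                MonGp.map ε.toMonoidHom
                  (divB (GlobalDivisorData.arith F).Φ (GlobalDivisorData.arith F).B (GlobalDivisorData.arith F).div (op A) w)) ∧
        (∀ ⦃X Y : (GlobalDivisorData.arith F).ModelGlobalFrobenioid⦄ (f g : X ⟶ Y), ModelFrobenioid.degFr f = 1 →
          ModelFrobenioid.degFr g = 1 → ModelFrobenioid.baseMap f = ModelFrobenioid.baseMap g →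
            ModelFrobenioid.unit (Ψ.functor.map f) *
                pull (GlobalDivisorData.arith F).B (A := X.base) (B := (Ψ.functor.obj X).base) (η'.hom.app X)
                  (ᾱ X.base (ModelFrobenioid.unit g)) =
              ModelFrobenioid.unit (Ψ.functor.map g) *
                pull (GlobalDivisorData.arith F).B (A := X.base) (B := (Ψ.functor.obj X).base) (η'.hom.app X)
                  (ᾱ X.base (ModelFrobenioid.unit f)))) :
    CatIsomorphism.RigidOverBase (GlobalDivisorData.arith F).modelBase :=
  Cor53.arith_rigidOverBase_of_ratioRigid F (arith_ratioRigid_of_unitsTransport F hA)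

/-- **[IUTchI] Cor 5.3 (i) AS PRINTED («bijective») at `ℱ^⊛(†𝒟^⊚)` from units transport and `hlift⊛`**:
`CatIsomorphism.DescendBijective` for `ℱ^⊛(†𝒟^⊚) → †𝒟^⊛`, the injectivity half through `hA` ⇒ `hB` ⇒ `hker⊛`, the
surjectivity half the DISPLAYED `hlift⊛` (abc-iut-w4-d109's ★ `Cor53iLiftsAllAtArithmeticGlobalModel` supplies it from
named facts). ([IUTchI] Cor 5.3 (i) p.144) [cite: MochizukiFrdI2008, Thm. 5.2(ii) p.101]
[claim: Mochizuki2012, status: disputed] -/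
theorem arith_descendBijective_of_unitsTransport_of_lifts
    (hA : ∀ (Ψ : (GlobalDivisorData.arith F).ModelGlobalFrobenioid ≌ (GlobalDivisorData.arith F).ModelGlobalFrobenioid)
      (η' : Ψ.functor ⋙ (GlobalDivisorData.arith F).modelBase ≅ (GlobalDivisorData.arith F).modelBase),
      ∃ ᾱ : ∀ A : BaseCat (absGalGrp F),
          (GlobalDivisorData.arith F).B.obj (op A) ≃* (GlobalDivisorData.arith F).B.obj (op A),
        (∀ ⦃A' A : BaseCat (absGalGrp F)⦄ (g : A' ⟶ A) (w : (GlobalDivisorData.arith F).B.obj (op A)),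
          ᾱ A' (pull (GlobalDivisorData.arith F).B g w) = pull (GlobalDivisorData.arith F).B g (ᾱ A w)) ∧
        (∀ A : BaseCat (absGalGrp F),
          ∃ ε : (GlobalDivisorData.arith F).Φ.obj (op A) ≃* (GlobalDivisorData.arith F).Φ.obj (op A),
            ∀ w : (GlobalDivisorData.arith F).B.obj (op A),
              divB (GlobalDivisorData.arith F).Φ (GlobalDivisorData.arith F).B (GlobalDivisorData.arith F).div (op A) (ᾱ A w) =
                MonGp.map ε.toMonoidHom
                  (divB (GlobalDivisorData.arith F).Φ (GlobalDivisorData.arith F).B (GlobalDivisorData.arith F).div (op A) w)) ∧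
        (∀ ⦃X Y : (GlobalDivisorData.arith F).ModelGlobalFrobenioid⦄ (f g : X ⟶ Y), ModelFrobenioid.degFr f = 1 →
          ModelFrobenioid.degFr g = 1 → ModelFrobenioid.baseMap f = ModelFrobenioid.baseMap g →
            ModelFrobenioid.unit (Ψ.functor.map f) *
                pull (GlobalDivisorData.arith F).B (A := X.base) (B := (Ψ.functor.obj X).base) (η'.hom.app X)
                  (ᾱ X.base (ModelFrobenioid.unit g)) =
              ModelFrobenioid.unit (Ψ.functor.map g) *
                pull (GlobalDivisorData.arith F).B (A := X.base) (B := (Ψ.functor.obj X).base) (η'.hom.app X)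
                  (ᾱ X.base (ModelFrobenioid.unit f))))
    (hlift : ∀ Θ : BaseCat (absGalGrp F) ≌ BaseCat (absGalGrp F),
      ∃ Ψ : (GlobalDivisorData.arith F).ModelGlobalFrobenioid ≌ (GlobalDivisorData.arith F).ModelGlobalFrobenioid,
        Nonempty (CatIsomorphism.LiesUnder (GlobalDivisorData.arith F).modelBase (GlobalDivisorData.arith F).modelBase Ψ Θ)) :
    CatIsomorphism.DescendBijective (GlobalDivisorData.arith F).modelBase (GlobalDivisorData.arith F).modelBase
      (GlobalDivisorData.hasUnder_modelBase_arith F F) (GlobalDivisorData.underUnique_modelBase_arith F F) :=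
  Cor53.arith_descendBijective_of_ratioRigid_of_lifts F (arith_ratioRigid_of_unitsTransport F hA) hlift

end Cor53

end Literature.IUT.HodgeTheaters

end
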